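import Literature.NumberTheory.Sieve.MatomakiRadziwillProp1U1
import HarnessLib

/-!
# Matomäki–Radziwiłł 2016, Proposition 1 for general coefficients — (d1) Lemma 12 on `𝒰` (§8.3)

Topic `NumberTheory/Sieve`.  Everything in this file is PROVED; no definitions, no named facts.

General-coefficient form of `MatomakiRadziwillProp1U1.lean` (K. Matomäki, M. Radziwiłł, *Multiplicative functions in
short intervals*, Ann. of Math. 183 (2016), §8.3, first display: the second application of Lemma 12 with
`a = b`): the coefficients `a` (supported anywhere, `|a| ≤ 1`) and `c` (`|c| ≤ 1`) are arbitrary complex sequences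
with `a_{mp} = a_m c_p` for primes `p ∈ [P', Q']`, `p ∤ m`, and the summation range `X ≥ 1` is independent of the
interval system's parameter (`I : SieveIntervalSystem η X₀`).  For a real multiplicative `f` the tree file takes
`a = f 1_𝒮`, `c = f` (`aCoef_mul_prime_of_gt`); for a completely multiplicative complex `f` the same choice works
(`mem_mul_prime_iff_of_gt`).  Needed for complex `f` in Matomäki–Radziwiłł–Tao 2015, Appendix A (Proposition A.3).

* `integral_Uset_le_lemma12_coef` — Lemma 12 on `𝒰` (`MatomakiRadziwillLemma12.lemma12_bound`, `C₁₂ = 20000`);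
* `coprime_sum_le_card_div_coef` — `∑_{(n,𝒫)=1} |a_n|²/n ≤ (1/X) #{X ≤ n ≤ 2X : (n,𝒫)=1}`.

## References
* K. Matomäki, M. Radziwiłł, Ann. of Math. (2) 183 (2016), 1015–1056 (arXiv:1501.04585), §8.3 (arXiv p. 17).
  [cite: MatomakiRadziwillAnnals2016, §8.3]
* K. Matomäki, M. Radziwiłł, T. Tao, Algebra & Number Theory 9 (2015), Appendix A, Proposition A.3 (proof).
  [cite: MatomakiRadziwillTao2015, Appendix A, Proposition A.3 (proof)]
-/

noncomputable section

open Finset Complex MeasureTheory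

namespace Literature.NumberTheory.Sieve

namespace SieveIntervalSystem

variable {η X₀ : ℝ} (I : SieveIntervalSystem η X₀)

/-- **Lemma 12 on `𝒰`, general coefficients** (§8.3, first display): for parameters `1 ≤ P' ≤ Q'`, `H' ≥ 1`,
`X, T ≥ 1`, `T₀ ≥ 0`, `1`-bounded `a, c` with `a_{mp} = a_m c_p` (`p ∈ [P', Q']` prime, `p ∤ m`), `C₁₂ = 20000`:
`∫_𝒰 |∑ a_n n^{-1-it}|² ≤ C₁₂ (H' log(Q'/P') ∑_{v} ∫_𝒰 |Q_{v,H'} R_{v,H'}|²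
  + (T+X)/X (1/H' + 1/P' + ∑_{X≤n≤2X, (n,∏_{P'≤p≤Q'} p)=1} |a_n|²/n))`.
[cite: MatomakiRadziwillAnnals2016, §8.3] -/
theorem integral_Uset_le_lemma12_coef (a c : ℕ → ℂ) (ha : ∀ n, ‖a n‖ ≤ 1) (hc : ∀ p, ‖c p‖ ≤ 1)
    {X : ℝ} (hX : 1 ≤ X) {T₀ T : ℝ} (hT₀ : 0 ≤ T₀) (hT : 1 ≤ T) {P' Q' H' : ℝ} (hP'1 : 1 ≤ P')
    (hP'Q' : P' ≤ Q') (hH' : 1 ≤ H')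
    (hfac : ∀ m p : ℕ, p.Prime → P' ≤ p → (p : ℝ) ≤ Q' → ¬ p ∣ m → a (m * p) = a m * c p) :
    ∫ t in I.Uset c T₀ T,
        ‖∑ n ∈ Icc ⌈X⌉₊ ⌊2 * X⌋₊, a n * (n : ℂ) ^ (-(1 + (t : ℂ) * Complex.I))‖ ^ 2 ≤
      20000 * ((H' * Real.log (Q' / P')) *
          (∑ v ∈ Icc ⌊H' * Real.log P'⌋₊ ⌊H' * Real.log Q'⌋₊,
            ∫ t in I.Uset c T₀ T,
              ‖blockPrimePoly c P' Q' H' v t * blockCofactorPoly a X P' Q' H' v t‖ ^ 2)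
        + (T + X) / X * (1 / H' + 1 / P'
            + ∑ n ∈ (Icc ⌈X⌉₊ ⌊2 * X⌋₊).filter
                (fun n : ℕ => ∀ p ∈ (Icc ⌈P'⌉₊ ⌊Q'⌋₊).filter Nat.Prime, ¬ p ∣ n),
                ‖a n‖ ^ 2 / n)) := by
  have hsub : I.Uset c T₀ T ⊆ Set.Icc (-T) T :=
    (I.Uset_subset _ T₀ T).trans (Set.Icc_subset_Icc (by linarith) le_rfl)
  exact MatomakiRadziwillLemma12.lemma12_bound X T P' Q' H' a a c (I.Uset c T₀ T) hX hT hP'1 hP'Q' hH'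
    ha ha hc hfac hsub

/-- The sieve term of Lemma 12 on `𝒰`, general coefficients: `∑_{X≤n≤2X, (n,𝒫)=1} |a_n|²/n ≤ (1/X) #{…}`
(`|a_n| ≤ 1`, `n ≥ X > 0`). [folklore] -/
theorem coprime_sum_le_card_div_coef {a : ℕ → ℂ} (ha : ∀ n, ‖a n‖ ≤ 1) {X : ℝ} (hX : 0 < X) (P' Q' : ℝ) :
    ∑ n ∈ (Icc ⌈X⌉₊ ⌊2 * X⌋₊).filter
        (fun n : ℕ => ∀ p ∈ (Icc ⌈P'⌉₊ ⌊Q'⌋₊).filter Nat.Prime, ¬ p ∣ n), ‖a n‖ ^ 2 / n ≤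
      (#((Icc ⌈X⌉₊ ⌊2 * X⌋₊).filter
          (fun n : ℕ => ∀ p ∈ (Icc ⌈P'⌉₊ ⌊Q'⌋₊).filter Nat.Prime, ¬ p ∣ n)) : ℝ) * (1 / X) := by
  rw [← nsmul_eq_mul, ← sum_const]
  refine sum_le_sum fun n hn => ?_
  have hXn : X ≤ n := Nat.ceil_le.1 (mem_Icc.1 (mem_filter.1 hn).1).1
  have hn0 : (0 : ℝ) < n := hX.trans_le hXn
  have h1 : ‖a n‖ ^ 2 ≤ 1 := by
    have := ha n
    have h0 := norm_nonneg (a n)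
    nlinarith only [this, h0]
  calc ‖a n‖ ^ 2 / n ≤ 1 / (n : ℝ) := div_le_div_of_nonneg_right h1 hn0.le
    _ ≤ 1 / X := div_le_div_of_nonneg_left zero_le_one hX hXn

end SieveIntervalSystem

end Literature.NumberTheory.Sieve
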